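import Summits.Ventures.PercRepro.RankLevelSetRuleQSliceBorderLarge

/-!
# PercRepro — THE EVEN FAMILIES WITH THE EVEN DECAY: `Φ(q+k, q) ≤ R̂(q, k, q−k+2)` for `k = 12, 14, …, 22` from sharper thresholds
(night-1, gen 20; dossier §31.10 cont. 11)

For even `k = 2i + 2` the chain of RankLevelSetRuleQSliceBorderLarge loses `√q` through `D_k ≤ D_{k−1}`. Here the EVEN half of
`slice_diag_decay` is used instead, `D_{2i+2}·q^{i+1} ≤ (i+1)!·2^i·(1 + X_q)` with `X_q = 4^q/C(2q, q)`, and the Wallis bound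
`X_q² ≤ 4q` (`xq_sq_le`) enters through the AM–GM device **`xq_le_amgm`**: `X_q ≤ q/t + t` for every `t > 0` (so `√q` never
appears). Then:
* **`border_even_of_keyX`** — `k = 2i + 2`, `i ≥ 1`, `q = m + 2i`, `(2i+1)(2i−2) ≤ 2m`, `t > 0`: if
  `2^{4i+1}·(i+1)!·2^i·(1 + (q/t + t))·4(q+1) ≤ (2i+1)(2i−1)·q^{i+1}` then `Φ(q+k, q) ≤ R̂(q, k, m)`;
* **`border_even_of_thresholdX`** — the same from the key inequality at a threshold `q₁ ≤ q` (it propagates since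
  `(q+1)(1 + q/t + t)/q^{i+1}` decreases for `i ≥ 2`);
* **`border_even_k12` … `border_even_k22`** — the instances with `q₁ = 137, 140, 147, 155, 170, 209` (`t = 11, 12, 10, 11, 11, 11`);
  for `k = 20, 22` the threshold IS `k(k−3)/2`, so those two families have no gap above the slope regime.
Axioms: standard.
-/

namespace PercRepro

open Finset

/-- **AM–GM for the Wallis bound**: `X_Q = 4^Q/C(2Q, Q) ≤ Q/t + t` for every `t > 0` (`Q ≥ 1`), from `X_Q² ≤ 4Q ≤ (Q/t + t)²`. -/
lemma xq_le_amgm (Q : ℕ) (hQ : 1 ≤ Q) (t : ℚ) (ht : 0 < t) :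
    (4 : ℚ) ^ Q / ((2 * Q).choose Q : ℚ) ≤ (Q : ℚ) / t + t := by
  have h := xq_sq_le Q hQ
  have hX0 : (0 : ℚ) ≤ (4 : ℚ) ^ Q / ((2 * Q).choose Q : ℚ) := by positivity
  have hQ0 : (0 : ℚ) ≤ Q := by positivity
  have hr : (0 : ℚ) ≤ (Q : ℚ) / t + t := by positivity
  have hsq : (4 : ℚ) * Q ≤ ((Q : ℚ) / t + t) ^ 2 := by
    have : ((Q : ℚ) / t + t) ^ 2 - 4 * Q = ((Q : ℚ) / t - t) ^ 2 := by field_simp; ring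
    nlinarith [sq_nonneg ((Q : ℚ) / t - t)]
  have h2 : ((4 : ℚ) ^ Q / ((2 * Q).choose Q : ℚ)) ^ 2 ≤ ((Q : ℚ) / t + t) ^ 2 := h.trans hsq
  exact (pow_le_pow_iff_left₀ hX0 hr (by norm_num : (2 : ℕ) ≠ 0)).1 h2

/-- **The even-`k` borderline from one numeric inequality, with the even decay** (`k = 2i + 2`, `i ≥ 1`, `q = m + 2i`,
`(2i+1)(2i−2) ≤ 2m`, `t > 0`): if `2^{4i+1}·(i+1)!·2^i·(1 + (q/t + t))·4(q+1) ≤ (2i+1)(2i−1)·q^{i+1}` then `Φ(q+k, q) ≤ R̂(q, k, m)`. -/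
theorem border_even_of_keyX (i m : ℕ) (t : ℚ) (hi : 1 ≤ i) (ht : 0 < t) (hm : (2 * i + 1) * (2 * i - 2) ≤ 2 * m)
    (hkey : (2 : ℚ) ^ (4 * i + 1) * (((i + 1).factorial : ℚ) * 2 ^ i) * (1 + (((m + 2 * i : ℕ) : ℚ) / t + t))
        * (4 * (((m + 2 * i : ℕ) : ℚ) + 1))
      ≤ (2 * (i : ℚ) + 1) * (2 * (i : ℚ) - 1) * ((m + 2 * i : ℕ) : ℚ) ^ (i + 1)) :
    phiK (m + 2 * i + (2 * i + 2)) (m + 2 * i) ≤ rhat (m + 2 * i) (2 * i + 2) m := by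
  refine phiK_le_rhat_border_of_tail m (2 * i) (by omega) hm ?_
  have hq1 : 1 ≤ m + 2 * i := by omega
  have hT1 := border_tail_le m (2 * i)
  have hd := (slice_diag_decay (m + 2 * i) hq1 i).2
  have hX := xq_le_amgm (m + 2 * i) hq1 t ht
  set Q := ((m + 2 * i : ℕ) : ℚ) with hQdef
  have hQ1 : (1 : ℚ) ≤ Q := by rw [hQdef]; exact_mod_cast hq1
  set D2 := ∑ a ∈ range (m + 2 * i + 1), ((m + 2 * i).choose a : ℚ)
      / ((m + 2 * i + (2 * i + 2) + a).choose (a + (2 * i + 2)) : ℚ) with hD2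
  set F := ((i + 1).factorial : ℚ) * 2 ^ i with hF
  have hF0 : 0 < F := by rw [hF]; positivity
  have hT2 : ∑ j ∈ range (2 * i + 1), ((2 * (2 * i) + 2).choose (2 * i + 2 + j) : ℚ)
      * ∑ a ∈ range (m + 1), (m.choose a : ℚ) / ((m + 2 * i + (2 * i + 2 + j) + a).choose (a + (2 * i + 2 + j)) : ℚ)
      ≤ (2 : ℚ) ^ (4 * i + 1) * D2 := by
    calc _ ≤ (2 : ℚ) ^ (2 * (2 * i) + 1) * D2 := hT1
      _ = (2 : ℚ) ^ (4 * i + 1) * D2 := by rw [show 2 * (2 * i) + 1 = 4 * i + 1 by ring]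
  refine hT2.trans ?_
  have ecast : (((2 * i : ℕ) : ℚ) + 1) * (((2 * i : ℕ) : ℚ) - 1) / (4 * ((m : ℚ) + ((2 * i : ℕ) : ℚ) + 1))
      = (2 * (i : ℚ) + 1) * (2 * (i : ℚ) - 1) / (4 * (Q + 1)) := by rw [hQdef]; push_cast; ring
  rw [ecast]
  have hQi : (0 : ℚ) < Q ^ (i + 1) := by positivity
  -- D2 ≤ F (1 + X) / Q^{i+1} ≤ F (1 + Q/t + t) / Q^{i+1}
  have hD2le : D2 ≤ F * (1 + (Q / t + t)) / Q ^ (i + 1) := by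
    rw [le_div_iff₀ hQi]
    have : (∑ a ∈ range (m + 2 * i + 1), ((m + 2 * i).choose a : ℚ)
        / ((m + 2 * i + (2 * i + 2) + a).choose (a + (2 * i + 2)) : ℚ)) * (Q : ℚ) ^ (i + 1)
        ≤ F * (1 + (4 : ℚ) ^ (m + 2 * i) / ((2 * (m + 2 * i)).choose (m + 2 * i) : ℚ)) := hd
    have hmono : F * (1 + (4 : ℚ) ^ (m + 2 * i) / ((2 * (m + 2 * i)).choose (m + 2 * i) : ℚ)) ≤ F * (1 + (Q / t + t)) :=
      mul_le_mul_of_nonneg_left (by linarith [hX]) hF0.le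
    exact this.trans hmono
  calc (2 : ℚ) ^ (4 * i + 1) * D2 ≤ (2 : ℚ) ^ (4 * i + 1) * (F * (1 + (Q / t + t)) / Q ^ (i + 1)) :=
        mul_le_mul_of_nonneg_left hD2le (by positivity)
    _ = (2 : ℚ) ^ (4 * i + 1) * F * (1 + (Q / t + t)) / Q ^ (i + 1) := by ring
    _ ≤ (2 * (i : ℚ) + 1) * (2 * (i : ℚ) - 1) / (4 * (Q + 1)) := by
        rw [div_le_div_iff₀ hQi (by positivity)]
        rw [hF, hQdef] at hkey ⊢
        linarith [hkey]


/-- Monotonicity of `(Q+1)(Q + t + t²)/Q^{i+1}` in `Q` (for `i ≥ 1`, `1 ≤ q₁ ≤ Q`, `t ≥ 0`), in product form: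
`(Q+1)(Q + t + t²)·q₁^{i+1} ≤ (q₁+1)(q₁ + t + t²)·Q^{i+1}`. -/
lemma border_even_mono (i : ℕ) (hi : 1 ≤ i) (q₁ Q t : ℚ) (hq₀ : 1 ≤ q₁) (hq : q₁ ≤ Q) (ht : 0 ≤ t) :
    (Q + 1) * (Q + t + t ^ 2) * q₁ ^ (i + 1) ≤ (q₁ + 1) * (q₁ + t + t ^ 2) * Q ^ (i + 1) := by
  have hq1 : 0 ≤ q₁ := by linarith
  have hQ0 : 0 ≤ Q := by linarith
  have hpm : q₁ ^ (i - 1) ≤ Q ^ (i - 1) := pow_le_pow_left₀ hq1 hq (i - 1)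
  have hpi : q₁ ^ i ≤ Q ^ i := pow_le_pow_left₀ hq1 hq i
  have hpi1 : q₁ ^ (i + 1) ≤ Q ^ (i + 1) := pow_le_pow_left₀ hq1 hq (i + 1)
  have e1 : q₁ ^ (i + 1) = q₁ ^ 2 * q₁ ^ (i - 1) := by rw [← pow_add]; congr 1; omega
  have e2 : Q ^ (i + 1) = Q ^ 2 * Q ^ (i - 1) := by rw [← pow_add]; congr 1; omega
  have e3 : q₁ ^ (i + 1) = q₁ * q₁ ^ i := by rw [← pow_succ']
  have e4 : Q ^ (i + 1) = Q * Q ^ i := by rw [← pow_succ']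
  have hA : Q ^ 2 * q₁ ^ (i + 1) ≤ q₁ ^ 2 * Q ^ (i + 1) := by
    rw [e1, e2]
    have := mul_le_mul_of_nonneg_left hpm (by positivity : (0 : ℚ) ≤ Q ^ 2 * q₁ ^ 2)
    nlinarith [this]
  have hB : Q * q₁ ^ (i + 1) ≤ q₁ * Q ^ (i + 1) := by
    rw [e3, e4]
    have := mul_le_mul_of_nonneg_left hpi (by positivity : (0 : ℚ) ≤ Q * q₁)
    nlinarith [this]
  have hc1 : (0 : ℚ) ≤ 1 + t + t ^ 2 := by positivity
  have hc2 : (0 : ℚ) ≤ t + t ^ 2 := by positivity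
  have hB' := mul_le_mul_of_nonneg_left hB hc1
  have hC' := mul_le_mul_of_nonneg_left hpi1 hc2
  have eL : (Q + 1) * (Q + t + t ^ 2) * q₁ ^ (i + 1)
      = Q ^ 2 * q₁ ^ (i + 1) + (1 + t + t ^ 2) * (Q * q₁ ^ (i + 1)) + (t + t ^ 2) * q₁ ^ (i + 1) := by ring
  have eR : (q₁ + 1) * (q₁ + t + t ^ 2) * Q ^ (i + 1)
      = q₁ ^ 2 * Q ^ (i + 1) + (1 + t + t ^ 2) * (q₁ * Q ^ (i + 1)) + (t + t ^ 2) * Q ^ (i + 1) := by ring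
  rw [eL, eR]
  linarith [hA, hB', hC']

/-- **The even-`k` borderline from a threshold, with the even decay** (`k = 2i + 2`, `i ≥ 1`, `q = m + 2i ≥ q₁ ≥ 1`,
`(2i+1)(2i−2) ≤ 2m`, `t > 0`): the key inequality at `q₁`, `2^{4i+1}·(i+1)!·2^i·(1 + (q₁/t + t))·4(q₁+1) ≤ (2i+1)(2i−1)·q₁^{i+1}`,
gives `Φ(q+k, q) ≤ R̂(q, k, m)` for every such `q`. -/
theorem border_even_of_thresholdX (i m q₁ : ℕ) (t : ℚ) (hi : 1 ≤ i) (ht : 0 < t) (hm : (2 * i + 1) * (2 * i - 2) ≤ 2 * m)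
    (hq₀ : 1 ≤ q₁) (hq₁ : q₁ ≤ m + 2 * i)
    (hnum : (2 : ℚ) ^ (4 * i + 1) * (((i + 1).factorial : ℚ) * 2 ^ i) * (1 + ((q₁ : ℚ) / t + t)) * (4 * ((q₁ : ℚ) + 1))
      ≤ (2 * (i : ℚ) + 1) * (2 * (i : ℚ) - 1) * (q₁ : ℚ) ^ (i + 1)) :
    phiK (m + 2 * i + (2 * i + 2)) (m + 2 * i) ≤ rhat (m + 2 * i) (2 * i + 2) m := by
  refine border_even_of_keyX i m t hi ht hm ?_
  set Q := ((m + 2 * i : ℕ) : ℚ) with hQdef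
  have hq : (q₁ : ℚ) ≤ Q := by rw [hQdef]; exact_mod_cast hq₁
  have hq0 : (1 : ℚ) ≤ q₁ := by exact_mod_cast hq₀
  set K := (2 : ℚ) ^ (4 * i + 1) * (((i + 1).factorial : ℚ) * 2 ^ i) with hK
  set R := (2 * (i : ℚ) + 1) * (2 * (i : ℚ) - 1) with hR
  have hK0 : 0 < K := by rw [hK]; positivity
  have hmono := border_even_mono i hi (q₁ : ℚ) Q t hq0 hq ht.le
  have et : ∀ x : ℚ, t * (1 + (x / t + t)) = x + t + t ^ 2 := fun x => by field_simp; ring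
  have hkq : K * (1 + ((q₁ : ℚ) / t + t)) * (4 * ((q₁ : ℚ) + 1)) ≤ R * (q₁ : ℚ) ^ (i + 1) := hnum
  have hq1pos : (0 : ℚ) < (q₁ : ℚ) ^ (i + 1) := by positivity
  have step1 : K * (Q + t + t ^ 2) * (4 * (Q + 1)) * (q₁ : ℚ) ^ (i + 1)
      ≤ K * ((q₁ : ℚ) + t + t ^ 2) * (4 * ((q₁ : ℚ) + 1)) * Q ^ (i + 1) := by
    have := mul_le_mul_of_nonneg_left hmono (by positivity : (0 : ℚ) ≤ 4 * K)
    nlinarith [this]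
  have step2 : K * ((q₁ : ℚ) + t + t ^ 2) * (4 * ((q₁ : ℚ) + 1)) * Q ^ (i + 1) ≤ R * (q₁ : ℚ) ^ (i + 1) * t * Q ^ (i + 1) := by
    have h := mul_le_mul_of_nonneg_left hkq ht.le
    have e : t * (K * (1 + ((q₁ : ℚ) / t + t)) * (4 * ((q₁ : ℚ) + 1))) = K * ((q₁ : ℚ) + t + t ^ 2) * (4 * ((q₁ : ℚ) + 1)) := by
      rw [← et (q₁ : ℚ)]; ring
    rw [e] at h
    have := mul_le_mul_of_nonneg_right h (by positivity : (0 : ℚ) ≤ Q ^ (i + 1))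
    linarith [this]
  have h3 : K * (Q + t + t ^ 2) * (4 * (Q + 1)) ≤ R * Q ^ (i + 1) * t := by
    have := step1.trans step2
    have h' : (K * (Q + t + t ^ 2) * (4 * (Q + 1))) * (q₁ : ℚ) ^ (i + 1) ≤ (R * Q ^ (i + 1) * t) * (q₁ : ℚ) ^ (i + 1) := by
      linarith [this]
    exact le_of_mul_le_mul_right h' hq1pos
  have e2 : K * (1 + (Q / t + t)) * (4 * (Q + 1)) * t = K * (Q + t + t ^ 2) * (4 * (Q + 1)) := by
    rw [← et Q]; ring
  have : K * (1 + (Q / t + t)) * (4 * (Q + 1)) * t ≤ R * Q ^ (i + 1) * t := by rw [e2]; exact h3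
  exact le_of_mul_le_mul_right this ht

/-- `k = 12` with the even decay: the borderline `Φ(q+12, q) ≤ R̂(q, 12, q − 10)` for every `q ≥ 137`. -/
theorem border_even_k12 (q : ℕ) (hq : 137 ≤ q) : phiK (q + 12) q ≤ rhat q 12 (q - 10) := by
  obtain ⟨m, rfl⟩ : ∃ m, q = m + 2 * 5 := ⟨q - 2 * 5, by omega⟩
  rw [show m + 2 * 5 - 10 = m by omega]
  exact border_even_of_thresholdX 5 m 137 11 (by norm_num) (by norm_num) (by omega) (by norm_num) (by omega)
    (by norm_num [Nat.factorial])

/-- `k = 14` with the even decay: the borderline `Φ(q+14, q) ≤ R̂(q, 14, q − 12)` for every `q ≥ 140`. -/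
theorem border_even_k14 (q : ℕ) (hq : 140 ≤ q) : phiK (q + 14) q ≤ rhat q 14 (q - 12) := by
  obtain ⟨m, rfl⟩ : ∃ m, q = m + 2 * 6 := ⟨q - 2 * 6, by omega⟩
  rw [show m + 2 * 6 - 12 = m by omega]
  exact border_even_of_thresholdX 6 m 140 12 (by norm_num) (by norm_num) (by omega) (by norm_num) (by omega)
    (by norm_num [Nat.factorial])

/-- `k = 16` with the even decay: the borderline `Φ(q+16, q) ≤ R̂(q, 16, q − 14)` for every `q ≥ 147`. -/
theorem border_even_k16 (q : ℕ) (hq : 147 ≤ q) : phiK (q + 16) q ≤ rhat q 16 (q - 14) := by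
  obtain ⟨m, rfl⟩ : ∃ m, q = m + 2 * 7 := ⟨q - 2 * 7, by omega⟩
  rw [show m + 2 * 7 - 14 = m by omega]
  exact border_even_of_thresholdX 7 m 147 10 (by norm_num) (by norm_num) (by omega) (by norm_num) (by omega)
    (by norm_num [Nat.factorial])

/-- `k = 18` with the even decay: the borderline `Φ(q+18, q) ≤ R̂(q, 18, q − 16)` for every `q ≥ 155`. -/
theorem border_even_k18 (q : ℕ) (hq : 155 ≤ q) : phiK (q + 18) q ≤ rhat q 18 (q - 16) := by
  obtain ⟨m, rfl⟩ : ∃ m, q = m + 2 * 8 := ⟨q - 2 * 8, by omega⟩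
  rw [show m + 2 * 8 - 16 = m by omega]
  exact border_even_of_thresholdX 8 m 155 11 (by norm_num) (by norm_num) (by omega) (by norm_num) (by omega)
    (by norm_num [Nat.factorial])

/-- `k = 20` with the even decay: the borderline `Φ(q+20, q) ≤ R̂(q, 20, q − 18)` for every `q ≥ 170` (= k(k−3)/2: no gap). -/
theorem border_even_k20 (q : ℕ) (hq : 170 ≤ q) : phiK (q + 20) q ≤ rhat q 20 (q - 18) := by
  obtain ⟨m, rfl⟩ : ∃ m, q = m + 2 * 9 := ⟨q - 2 * 9, by omega⟩
  rw [show m + 2 * 9 - 18 = m by omega]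
  exact border_even_of_thresholdX 9 m 170 11 (by norm_num) (by norm_num) (by omega) (by norm_num) (by omega)
    (by norm_num [Nat.factorial])

/-- `k = 22` with the even decay: the borderline `Φ(q+22, q) ≤ R̂(q, 22, q − 20)` for every `q ≥ 209` (= k(k−3)/2: no gap). -/
theorem border_even_k22 (q : ℕ) (hq : 209 ≤ q) : phiK (q + 22) q ≤ rhat q 22 (q - 20) := by
  obtain ⟨m, rfl⟩ : ∃ m, q = m + 2 * 10 := ⟨q - 2 * 10, by omega⟩
  rw [show m + 2 * 10 - 20 = m by omega]
  exact border_even_of_thresholdX 10 m 209 11 (by norm_num) (by norm_num) (by omega) (by norm_num) (by omega)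
    (by norm_num [Nat.factorial])

end PercRepro
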